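import Literature.ModelTheory.ExponentialFields.PilaWilkieUnaryParametrization
import Literature.ModelTheory.ExponentialFields.OMinimalLimits
import Mathlib.Analysis.Calculus.UniformLimitsDeriv
import Mathlib.Topology.MetricSpace.Lipschitz
import HarnessLib

/-!
# Limits of definable families with bounded derivatives (Pila–Wilkie 2006, §4, "Some questions of convergence")

Topic `Literature/ModelTheory/ExponentialFields`; proof file in the cone of the named fact
`PilaWilkie2006_thm_1_8`, preparing the higher-dimensional `r`-parametrization (Pila–Wilkie
2006, §§4–5).  Printed (§4): *"suppose that `{F_t : (0,1) → (0,1)^N : t ∈ (0,1)}` is a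
definable family of functions … all the functions `F_t` are of class `C^{(r)}`, and that their
derivatives `F_t^{(i)}` are strongly bounded for `i = 0, …, r`. … Using o-minimality we may
define a function `F_0 : (0,1) → [0,1]^N` by `F_0(x) = lim_{t→0⁺} F_t(x)`. … One can now go on to
show that for each `i = 0, …, r − 1`, `F_0` is of class `C^{(i)}`, `F_0^{(i)}` is strongly
bounded and, indeed, that `F_0^{(i)}(x) = lim_{t→0⁺} F_t^{(i)}(x)` … (borrowed and modified from
the classical theory) `Ω^{(r)}` is 'definably compactly' contained in `Ω^{(r−1)}`"*.

Over the reals the classical theory applies directly: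

* `tendstoLocallyUniformlyOn_of_lipschitzOnWith` — equi-Lipschitz families converging
  pointwise converge locally uniformly; `lipschitzOnWith_of_deriv_bound`;
* `PilaWilkie2006_sec4_limit` — for a family `f_t` of `C^r` functions on an open interval with
  `|f_t^{(i)}| ≤ c` (`i ≤ r`) whose derivatives of order `< r` converge pointwise along a
  filter, the limit `g` is `C^{r−1}` with `f_t^{(i)} → g^{(i)}` and `|g^{(i)}| ≤ c` (`i < r`)
  (Mathlib's `hasDerivAt_of_tendstoLocallyUniformlyOn`);
* the o-minimal input: `exists_tendsto_nhdsGT_of_bounded` — bounded definable functions have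
  real one-sided limits (van den Dries 1998, Ch. 3, (1.6) Cor. 1, via the tree's
  `tendsto_nhdsGT_or`); and `definableFun_limRight` — the right limit at `0` of a definable
  family is a definable function of the parameters.

Nothing here is a named fact; no definitions.

## References

* J. Pila, A. J. Wilkie, *The rational points of a definable set*, Duke Math. J. 133 (2006),
  §4. [PilaWilkie2006]
* L. van den Dries, *Tame topology and o-minimal structures*, CUP 1998, Ch. 3, (1.6).
  [Dries1998]
-/

noncomputable section

open Set FirstOrder FirstOrder.Language Filter Topology

namespace Literature.ModelTheory.ExponentialFields

/-! ### Pila–Wilkie 2006, §4: limits of families with uniformly bounded derivatives -/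

section Convergence

/-- **Equi-Lipschitz families converging pointwise converge locally uniformly** (the classical
input of Pila–Wilkie 2006, §4: *"`Ω^{(r)}` is 'definably compactly' contained in `Ω^{(r-1)}`"*):
if all `f_t` are `K`-Lipschitz on an open set `s ⊆ ℝ` and `f_t x → g x` for every `x ∈ s`
along a filter `l`, then `f_t → g` locally uniformly on `s`. [folklore] -/
theorem tendstoLocallyUniformlyOn_of_lipschitzOnWith {ι : Type*} {l : Filter ι} [l.NeBot] {s : Set ℝ}
    (hs : IsOpen s) {f : ι → ℝ → ℝ} {g : ℝ → ℝ} {K : NNReal}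
    (hlip : ∀ t, LipschitzOnWith K (f t) s)
    (hpt : ∀ x ∈ s, Tendsto (fun t => f t x) l (𝓝 (g x))) :
    TendstoLocallyUniformlyOn f g l s := by
  -- the limit is `K`-Lipschitz as well
  have hglip : LipschitzOnWith K g s := by
    refine LipschitzOnWith.of_dist_le_mul fun x hx y hy => ?_
    have h : Tendsto (fun t => dist (f t x) (f t y)) l (𝓝 (dist (g x) (g y))) :=
      (hpt x hx).dist (hpt y hy)
    exact le_of_tendsto' h fun t => (hlip t).dist_le_mul x hx y hy
  rw [Metric.tendstoLocallyUniformlyOn_iff]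
  intro ε hε x hx
  -- a small ball around `x` inside `s`, of radius `δ` with `K δ ≤ ε / 3`
  obtain ⟨ρ, hρ, hball⟩ := Metric.isOpen_iff.mp hs x hx
  set δ : ℝ := min (ρ / 2) (ε / (3 * (K + 1))) with hδ
  have hδpos : 0 < δ := lt_min (by linarith) (by positivity)
  have hδρ : δ < ρ := (min_le_left _ _).trans_lt (by linarith)
  have hKδ : (K : ℝ) * δ ≤ ε / 3 := by
    have h1 : δ ≤ ε / (3 * (K + 1)) := min_le_right _ _
    have hK0 : (0 : ℝ) ≤ K := K.coe_nonneg
    calc (K : ℝ) * δ ≤ (K + 1) * (ε / (3 * (K + 1))) := by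
          apply mul_le_mul (by linarith) h1 hδpos.le (by linarith)
      _ = ε / 3 := by field_simp
  refine ⟨Metric.ball x δ, mem_nhdsWithin_of_mem_nhds (Metric.ball_mem_nhds x hδpos), ?_⟩
  have hεx : ∀ᶠ t in l, dist (f t x) (g x) < ε / 3 := by
    have h := hpt x hx
    rw [Metric.tendsto_nhds] at h
    exact h (ε / 3) (by linarith)
  filter_upwards [hεx] with t ht y hy
  have hys : y ∈ s := hball ((Metric.ball_subset_ball hδρ.le) hy)
  have hxy : dist y x < δ := hy
  have h1 : dist (g y) (g x) ≤ K * dist y x := hglip.dist_le_mul y hys x hx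
  have h2 : dist (f t x) (f t y) ≤ K * dist x y := (hlip t).dist_le_mul x hx y hys
  have h3 : dist (g x) (f t x) < ε / 3 := by rw [dist_comm]; exact ht
  have h4 : (K : ℝ) * dist y x ≤ K * δ := mul_le_mul_of_nonneg_left hxy.le K.coe_nonneg
  calc dist (g y) (f t y) ≤ dist (g y) (g x) + dist (g x) (f t x) + dist (f t x) (f t y) :=
        dist_triangle4 _ _ _ _
    _ < K * δ + ε / 3 + K * δ := by
        rw [dist_comm x y] at h2
        linarith
    _ ≤ ε := by linarith

/-- **`C¹` functions with bounded derivative on an open interval are Lipschitz there.**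
[folklore] -/
theorem lipschitzOnWith_of_deriv_bound {f : ℝ → ℝ} {a b : ℝ} {C : NNReal}
    (hf : DifferentiableOn ℝ f (Ioo a b)) (hb : ∀ x ∈ Ioo a b, |deriv f x| ≤ C) :
    LipschitzOnWith C f (Ioo a b) := by
  refine LipschitzOnWith.of_dist_le_mul fun x hx y hy => ?_
  rw [Real.dist_eq, Real.dist_eq]
  have h := (convex_Ioo a b).norm_image_sub_le_of_norm_deriv_le (fun z hz => (hf z hz).differentiableAt (isOpen_Ioo.mem_nhds hz))
    (fun z hz => by rw [Real.norm_eq_abs]; exact hb z hz) hy hx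
  simpa [Real.norm_eq_abs] using h


/-- **Pila–Wilkie 2006, §4 (limits of families with uniformly bounded derivatives), over `ℝ`.**
Printed: *"One can now go on to show that for each `i = 0, …, r − 1`, `F_0` is of class `C^{(i)}`,
`F_0^{(i)}` is strongly bounded and, indeed, that `F_0^{(i)}(x) = lim_{t→0⁺} F_t^{(i)}(x)` for
each `x ∈ (0,1)` … `Ω^{(r)}` is 'definably compactly' contained in `Ω^{(r-1)}`"*.  Here, for a
family `f_t` (`t` along a filter) of functions `C^r` on an open interval `s` (`r ≥ 1`) with
`|f_t^{(i)}| ≤ c` on `s` for `i ≤ r`, whose derivatives of order `< r` converge pointwise on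
`s` (the o-minimal input: definable one-parameter families have one-sided limits): the pointwise
limit `g` is `C^{r-1}` on `s`, `f_t^{(i)} → g^{(i)}` pointwise for `i < r`, and `|g^{(i)}| ≤ c`
(derivatives within `s`). Classical proof: equi-Lipschitz families converge locally uniformly
(`tendstoLocallyUniformlyOn_of_lipschitzOnWith`) and Mathlib's
`hasDerivAt_of_tendstoLocallyUniformlyOn`. [cite: PilaWilkie2006, §4] -/
theorem PilaWilkie2006_sec4_limit {ι : Type*} {l : Filter ι} [l.NeBot] {a b : ℝ} {r : ℕ} (hr : 1 ≤ r)
    {f : ι → ℝ → ℝ} {c : ℝ} (hc : 0 ≤ c)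
    (hf : ∀ t, ContDiffOn ℝ r (f t) (Ioo a b))
    (hb : ∀ t, ∀ i ≤ r, ∀ x ∈ Ioo a b, |iteratedDerivWithin i (f t) (Ioo a b) x| ≤ c)
    (hlim : ∀ i < r, ∀ x ∈ Ioo a b, ∃ y, Tendsto (fun t => iteratedDerivWithin i (f t) (Ioo a b) x) l (𝓝 y)) :
    ∃ g : ℝ → ℝ, ContDiffOn ℝ ((r - 1 : ℕ) : WithTop ℕ∞) g (Ioo a b) ∧
      (∀ i < r, ∀ x ∈ Ioo a b,
        Tendsto (fun t => iteratedDerivWithin i (f t) (Ioo a b) x) l (𝓝 (iteratedDerivWithin i g (Ioo a b) x))) ∧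
      (∀ i < r, ∀ x ∈ Ioo a b, |iteratedDerivWithin i g (Ioo a b) x| ≤ c) := by
  classical
  set s := Ioo a b with hs
  have hso : IsOpen s := isOpen_Ioo
  have hsu : UniqueDiffOn ℝ s := uniqueDiffOn_Ioo a b
  -- the pointwise limits `G i x` of the `i`-th derivatives, `i < r` (junk elsewhere)
  set G : ℕ → ℝ → ℝ := fun i x =>
    if h : i < r ∧ x ∈ s then (hlim i h.1 x h.2).choose else 0 with hG
  have hGlim : ∀ i < r, ∀ x ∈ s,
      Tendsto (fun t => iteratedDerivWithin i (f t) s x) l (𝓝 (G i x)) := by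
    intro i hi x hx
    have h : i < r ∧ x ∈ s := ⟨hi, hx⟩
    simp only [hG, dif_pos h]
    exact (hlim i hi x hx).choose_spec
  -- the `i`-th derivatives are `c`-Lipschitz (`i < r`)
  set C : NNReal := ⟨c, hc⟩ with hC
  have hderiv : ∀ t, ∀ i < r, ∀ x ∈ s,
      HasDerivAt (iteratedDerivWithin i (f t) s) (iteratedDerivWithin (i + 1) (f t) s x) x := by
    intro t i hi x hx
    have hd : DifferentiableOn ℝ (iteratedDerivWithin i (f t) s) s :=
      (hf t).differentiableOn_iteratedDerivWithin (by exact_mod_cast hi) hsu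
    have hda : DifferentiableAt ℝ (iteratedDerivWithin i (f t) s) x :=
      (hd x hx).differentiableAt (hso.mem_nhds hx)
    have h := hda.hasDerivAt
    rw [iteratedDerivWithin_succ, derivWithin_of_isOpen hso hx]
    exact h
  have hlip : ∀ t, ∀ i < r, LipschitzOnWith C (iteratedDerivWithin i (f t) s) s := by
    intro t i hi
    refine lipschitzOnWith_of_deriv_bound (fun x hx => (hderiv t i hi x hx).differentiableAt.differentiableWithinAt)
      fun x hx => ?_
    rw [(hderiv t i hi x hx).deriv]
    exact hb t (i + 1) (by omega) x hx
  have hloc : ∀ i < r, TendstoLocallyUniformlyOn (fun t => iteratedDerivWithin i (f t) s) (G i) l s :=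
    fun i hi => tendstoLocallyUniformlyOn_of_lipschitzOnWith hso (fun t => hlip t i hi) (hGlim i hi)
  -- `G i` has derivative `G (i+1)` on `s` for `i + 1 < r`
  have hGderiv : ∀ i, i + 1 < r → ∀ x ∈ s, HasDerivAt (G i) (G (i + 1) x) x := by
    intro i hi x hx
    refine hasDerivAt_of_tendstoLocallyUniformlyOn hso (hloc (i + 1) hi)
      (Filter.Eventually.of_forall fun t y hy => hderiv t i (by omega) y hy) (hGlim i (by omega)) hx
  -- hence `iteratedDerivWithin i (G 0) s = G i` on `s`, `i < r`
  have hGiter : ∀ i < r, EqOn (iteratedDerivWithin i (G 0) s) (G i) s := by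
    intro i
    induction i with
    | zero => intro _ x _; simp
    | succ i ih =>
      intro hi x hx
      have ih' := ih (by omega)
      rw [iteratedDerivWithin_succ]
      have h1 : derivWithin (iteratedDerivWithin i (G 0) s) s x = derivWithin (G i) s x :=
        derivWithin_congr ih' (ih' hx)
      rw [h1, derivWithin_of_isOpen hso hx, (hGderiv i hi x hx).deriv]
  refine ⟨G 0, ?_, fun i hi x hx => ?_, fun i hi x hx => ?_⟩
  · -- `C^{r-1}` via continuity/differentiability of the `iteratedDerivWithin`
    apply contDiffOn_of_continuousOn_differentiableOn_deriv
    · intro m hm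
      have hm' : m < r := by
        have : (m : ℕ∞) ≤ ((r - 1 : ℕ) : ℕ∞) := by exact_mod_cast hm
        have h2 : m ≤ r - 1 := by exact_mod_cast this
        omega
      have hGl : LipschitzOnWith C (G m) s := by
        refine LipschitzOnWith.of_dist_le_mul fun x hx y hy => ?_
        have h : Tendsto (fun t => dist (iteratedDerivWithin m (f t) s x) (iteratedDerivWithin m (f t) s y)) l
            (𝓝 (dist (G m x) (G m y))) := (hGlim m hm' x hx).dist (hGlim m hm' y hy)
        exact le_of_tendsto' h fun t => (hlip t m hm').dist_le_mul x hx y hy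
      exact hGl.continuousOn.congr (hGiter m hm')
    · intro m hm
      have hm' : m + 1 < r := by
        have : (m : ℕ∞) < ((r - 1 : ℕ) : ℕ∞) := by exact_mod_cast hm
        have h2 : m < r - 1 := by exact_mod_cast this
        omega
      intro x hx
      have h := (hGderiv m hm' x hx).differentiableAt.differentiableWithinAt (s := s)
      exact h.congr (fun y hy => hGiter m (by omega) hy) (hGiter m (by omega) hx)
  · rw [(hGiter i hi) hx]
    exact hGlim i hi x hx
  · rw [(hGiter i hi) hx]
    exact le_of_tendsto' ((hGlim i hi x hx).abs) fun t => hb t i hi.le x hx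

end Convergence


/-! ### One-sided limits of definable families: existence and definability -/

section Limits

variable {L : Language} [L.Structure ℝ] {β : Type}

/-- **Bounded definable functions have real one-sided limits** (van den Dries 1998, Ch. 3,
(1.6) Cor. 1; Wilkie 2015, Ex. 4.1): if `h : ℝ → ℝ` has definable graph in an o-minimal
structure on `ℝ` (with `<` definable) and `|h| ≤ c` on some `(p, p + δ)`, then `lim_{t → p⁺} h(t)`
exists in `ℝ`. [cite: Dries1998, Ch. 3 (1.6)] -/
theorem exists_tendsto_nhdsGT_of_bounded (hO : L.IsOMinimal ℝ)
    (hlt : (univ : Set ℝ).Definable L {v : Fin 2 → ℝ | v 0 < v 1})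
    {h : ℝ → ℝ} (hh : (univ : Set ℝ).Definable L {v : Fin 2 → ℝ | v 1 = h (v 0)})
    {p δ c : ℝ} (hδ : 0 < δ) (hb : ∀ t ∈ Ioo p (p + δ), |h t| ≤ c) :
    ∃ y, Tendsto h (𝓝[>] p) (𝓝 y) := by
  have hev : ∀ᶠ t in 𝓝[>] p, |h t| ≤ c := by
    filter_upwards [Ioo_mem_nhdsGT (show p < p + δ by linarith)] with t ht using hb t ht
  rcases tendsto_nhdsGT_or hO hlt hh p with h1 | h2 | h3
  · exact h1
  · exfalso
    have hboth := (h2.eventually (eventually_gt_atTop c)).and hev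
    obtain ⟨t, ht1, ht2⟩ := hboth.exists
    exact absurd ht1 (not_lt.mpr ((le_abs_self (h t)).trans ht2))
  · exfalso
    have hboth := (h3.eventually (eventually_lt_atBot (-c))).and hev
    obtain ⟨t, ht1, ht2⟩ := hboth.exists
    have := neg_abs_le (h t)
    linarith

open Classical in
/-- **The right limit at `0` of a definable family is a definable function of the parameters**
(with the junk value `0` where no real limit exists): `y = lim_{t→0⁺} Φ v t` is first order
(`∀ ε > 0 ∃ δ > 0 ∀ t, 0 < t < δ → |Φ v t − y| < ε`). [folklore] -/
theorem definableFun_limRight [Finite β]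
    (hadd : (univ : Set ℝ).Definable L {v : Fin 3 → ℝ | v 0 + v 1 = v 2})
    (hmul : (univ : Set ℝ).Definable L {v : Fin 3 → ℝ | v 0 * v 1 = v 2})
    {Φ : (β → ℝ) → ℝ → ℝ} (hΦ : IsDefinableFamily₁ L Φ) :
    (univ : Set ℝ).DefinableFun L (fun v : β → ℝ =>
      if h : ∃ y, Tendsto (Φ v) (𝓝[>] 0) (𝓝 y) then h.choose else 0) := by
  classical
  have hlt := definable_lt_of_field hadd hmul
  -- the first-order form of `Tendsto (Φ v) (𝓝[>] 0) (𝓝 y)`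
  have htend : ∀ v y, Tendsto (Φ v) (𝓝[>] 0) (𝓝 y) ↔
      ∀ ε : ℝ, 0 < ε → ∃ δ : ℝ, 0 < δ ∧ ∀ t : ℝ, 0 < t → t < δ → Φ v t - y < ε ∧ y - Φ v t < ε := by
    intro v y
    rw [Metric.tendsto_nhdsWithin_nhds]
    simp only [mem_Ioi, Real.dist_eq, abs_sub_lt_iff, sub_zero]
    constructor
    · intro H ε hε
      obtain ⟨δ, hδ, hH⟩ := H ε hε
      refine ⟨δ, hδ, fun t ht htδ => hH ht ?_⟩
      rw [abs_of_pos ht]; exact htδ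
    · intro H ε hε
      obtain ⟨δ, hδ, hH⟩ := H ε hε
      refine ⟨δ, hδ, fun {t} ht htδ => hH t ht ?_⟩
      rw [abs_of_pos ht] at htδ; exact htδ
  -- uniqueness of limits makes the graph first order
  unfold Set.DefinableFun
  have key : Function.tupleGraph (fun v : β → ℝ =>
      if h : ∃ y, Tendsto (Φ v) (𝓝[>] 0) (𝓝 y) then h.choose else 0) =
      {w : Option β → ℝ | Tendsto (Φ (w ∘ some)) (𝓝[>] 0) (𝓝 (w none)) ∨
        (¬ (∃ y, Tendsto (Φ (w ∘ some)) (𝓝[>] 0) (𝓝 y)) ∧ w none = 0)} := by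
    ext w
    simp only [Function.tupleGraph, mem_setOf_eq]
    by_cases h : ∃ y, Tendsto (Φ (w ∘ some)) (𝓝[>] 0) (𝓝 y)
    · rw [dif_pos h]
      have hspec := h.choose_spec
      constructor
      · intro hw; left; rw [← hw]; exact hspec
      · rintro (hw | ⟨hbad, -⟩)
        · exact tendsto_nhds_unique hspec hw
        · exact absurd h hbad
    · rw [dif_neg h]
      constructor
      · intro hw; right; exact ⟨h, hw.symm⟩
      · rintro (hw | ⟨-, hw⟩)
        · exact absurd ⟨_, hw⟩ h
        · exact hw.symm
  rw [key]
  -- definability of `{w | Tendsto (Φ (w ∘ some)) (𝓝[>] 0) (𝓝 (s w))}` for definable `s`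
  have hT : ∀ {γ : Type} [Finite γ] (q : (γ → ℝ) → β → ℝ) (s : (γ → ℝ) → ℝ),
      (univ : Set ℝ).DefinableMap L q → (univ : Set ℝ).DefinableFun L s →
      (univ : Set ℝ).Definable L {u : γ → ℝ | Tendsto (Φ (q u)) (𝓝[>] 0) (𝓝 (s u))} := by
    intro γ _ q s hq hs
    have heq : {u : γ → ℝ | Tendsto (Φ (q u)) (𝓝[>] 0) (𝓝 (s u))} = {u | ∀ ε : ℝ, 0 < ε →
        ∃ δ : ℝ, 0 < δ ∧ ∀ t : ℝ, 0 < t → t < δ → Φ (q u) t - s u < ε ∧ s u - Φ (q u) t < ε} := by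
      ext u; exact htend _ _
    rw [heq]
    -- innermost variables `w : ((γ ⊕ Unit) ⊕ Unit) ⊕ Unit → ℝ`: `u, ε, δ, t`
    have hq₃ : (univ : Set ℝ).DefinableMap L
        (fun w : ((γ ⊕ Unit) ⊕ Unit) ⊕ Unit → ℝ => q (w ∘ fun i => Sum.inl (Sum.inl (Sum.inl i)))) :=
      fun b => (hq b).comp (definableMap_comp_index _)
    have hs₃ : (univ : Set ℝ).DefinableFun L
        (fun w : ((γ ⊕ Unit) ⊕ Unit) ⊕ Unit → ℝ => s (w ∘ fun i => Sum.inl (Sum.inl (Sum.inl i)))) :=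
      hs.comp (definableMap_comp_index _)
    have hΦt : (univ : Set ℝ).DefinableFun L
        (fun w : ((γ ⊕ Unit) ⊕ Unit) ⊕ Unit → ℝ => Φ (q (w ∘ fun i => Sum.inl (Sum.inl (Sum.inl i)))) (w (Sum.inr ()))) :=
      hΦ.definableFun hq₃ (definableFun_proj _)
    apply definable_setOf_forall
    refine definable_setOf_imp (definable_setOf_lt hlt (definableFun_const' _ _) (definableFun_proj _)) ?_
    apply definable_setOf_exists
    refine definable_setOf_and (definable_setOf_lt hlt (definableFun_const' _ _) (definableFun_proj _)) ?_
    apply definable_setOf_forall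
    exact definable_setOf_imp (definable_setOf_lt hlt (definableFun_const' _ _) (definableFun_proj _))
      (definable_setOf_imp (definable_setOf_lt hlt (definableFun_proj _) (definableFun_proj _))
        (definable_setOf_and
          (definable_setOf_lt hlt (definableFun_sub hadd hΦt hs₃) (definableFun_proj _))
          (definable_setOf_lt hlt (definableFun_sub hadd hs₃ hΦt) (definableFun_proj _))))
  have hsome : (univ : Set ℝ).DefinableMap L (fun (w : Option β → ℝ) (b : β) => w (some b)) :=
    fun b => definableFun_proj _
  have hA : (univ : Set ℝ).Definable L
      {w : Option β → ℝ | Tendsto (Φ (w ∘ some)) (𝓝[>] 0) (𝓝 (w none))} :=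
    hT (fun w b => w (some b)) (fun w => w none) hsome (definableFun_proj _)
  have hB : (univ : Set ℝ).Definable L
      {w : Option β → ℝ | ∃ y, Tendsto (Φ (w ∘ some)) (𝓝[>] 0) (𝓝 y)} := by
    apply definable_setOf_exists
    exact hT (fun w b => w (Sum.inl (some b))) (fun w => w (Sum.inr ())) (fun b => definableFun_proj _)
      (definableFun_proj _)
  exact definable_setOf_or hA (definable_setOf_and (definable_setOf_not hB)
    (definable_setOf_eq' (definableFun_proj _) (definableFun_const' _ _)))

end Limits


end Literature.ModelTheory.ExponentialFields

end
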